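/-
Copyright (c) 2026 the pub-hodgecm-mathlib formalisation cell (harness21).  Prover seat hodgecm-mathlib-K2E5-p17 (g10), Track B ∕ K2-LIT, h413 = `stmt-HodgeConjecture-24833`,
R90-TF section S8 «ContSpec-n½ ∕ ResidualSpectrum», (R)′τ `hunfK` rows, structural letter «PT-DECOMP» (S8 dealer R90-CS-plan (g4) S8-R309 (3); consumers F0P2-p11 (g4)'s ★
`K2E1ChiUnfoldingRowKFiniteU3.hunfK_at_of_pureTensorSum` and K2E3-p36 (g4)'s W1-τ ROWS `hPT`).
-/
import Literature.NumberTheory.Automorphic.UnitaryGroupAdelicProduct            -- ★ `archPart`, `finPart`, `archToAdelic_mul_finAdelicToAdelic`, `continuous_archPart` (brings ★ `archToAdelic`, `finAdelicToAdelic`, their continuity)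
import Literature.LinearAlgebra.Subspace.SeparatelySpannedFunctions               -- ★ `exists_points_eval_injective` (finitely many points detect a finite-dimensional space of functions)
import Mathlib.LinearAlgebra.Basis.VectorSpace                                    -- Mathlib `LinearMap.exists_leftInverse_of_injective`
import Mathlib.Algebra.BigOperators.Pi                                           -- Mathlib `pi_eq_sum_univ`
import HarnessLib

/-!
# S8 (R)′τ — `R90S8ChiSectionPureTensorDecompositionU3`: «PT-DECOMP» — a function on `U(J)(𝔸_F)` whose finite slices `g_f ↦ φ((x_∞, g_f))` lie in a FINITE-DIMENSIONAL space of
# functions on `U(J)(𝔸_{F,f})` IS A FINITE SUM OF PURE TENSORS `φ(g) = Σ_j φ((g_∞, y_j))·Φf_j(g_f)` — with the archimedean factors SLICES of `φ` (continuity and bounds for free)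

Track B ∕ K2-LIT, crux h413 = `stmt-HodgeConjecture-24833`, route of record `HCCMUnconditional`; cell `hodgecm-mathlib`, R90-TF programme, section S8.  THEOREMS ONLY (no `def`, no
`instance`, no notation, no named-fact hypothesis, no `sorry`; default heartbeats); lane `--kind proof --supports stmt-HodgeConjecture-24833 --as helper` (count-neutral); imports ★
Literature only.  CLOSES NO SOCKET.  Generic `(F, E, c, N, J)` throughout (the CM `U(J₃)` reading is the instance `F = L⁺, E = L, N = 3, J = J₃`, no separate statement needed).

WHERE THIS SITS.  The W1 `hunfK` rows of (R)′τ (★ `hunfK_at_of_pureTensorSum`, F0P2-p11) unfold a K-finite τ-generator GIVEN as a finite sum of pure tensors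
`∑ i ∈ s, fun g => Φinf i (archPart … g) * Φf i (finPart … g)` with `Φinf i` continuous and bounded; the structural letter «PT-DECOMP» (S8-R308 (3) ∕ S8-R309 (3)) is the existence of
such a presentation for a continuous section at a finite level.  THIS FILE proves the presentation LETTER-FREE from ONE finiteness datum: the finite slices of `φ` lie in a
finite-dimensional space `W` of functions on `G_f = U(J)(𝔸_{F,f})` (for a `(χ₁,χ₂)`-pair section right-invariant under `ι_f(U₀)`, `U₀` open, `W` = the `B(𝔸_f)`-equivariant
right-`U₀`-invariant functions, finite-dimensional by the finite-adelic Iwasawa decomposition — the named input FIN_f, carried by the consumer as `[FiniteDimensional ℂ W]` + `hslice`).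
* §1 (generic linear algebra over a field) **`exists_sum_slice_mul_of_mem_finiteDimensional`**: `W ≤ (Y → K)` finite-dimensional, `f : X → Y → K` with every slice `f x ∈ W` ⟹
  `∃ d (y : Fin d → Y) (b : Fin d → Y → K), (∀ j, b j ∈ W) ∧ ∀ x y′, f x y′ = ∑ j, f x (y j) * b j y′`.  Proof: `d = dim W` points `y_j` detect `W` (★ `exists_points_eval_injective`), so
  the restriction `R : W → K^d` is injective and has a left inverse `S` (Mathlib `LinearMap.exists_leftInverse_of_injective`); `w = S(R w) = Σ_j w(y_j)•S(e_j)`.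
* §2 (adelic) **`exists_finset_sum_pureTensor_of_slices`**: for `φ : U(J)(𝔸_F) → ℂ` with slices `y ↦ φ(ι_∞ x · ι_f y)` in a finite-dimensional `W`:
  `φ g = ∑ j, φ(ι_∞(g_∞)·ι_f(y_j)) · Φf_j(g_f)` with `Φf_j ∈ W` (★ `archToAdelic_mul_finAdelicToAdelic`: `g = ι_∞(g_∞)·ι_f(g_f)`); **`exists_finset_sum_pureTensor_of_slices'`** — the
  same as an equality of FUNCTIONS in the consumer's shape `φ = ∑ j ∈ univ, fun g => Φinf j (archPart g) * Φf j (finPart g)` with `Φinf j := fun x => φ(ι_∞ x · ι_f y_j)` packaged with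
  its continuity (from `Continuous φ`) and its bound (from `‖φ‖ ≤ M`) — the binders `hΦc hΦM` of ★ `hunfK_at_of_pureTensorSum`.
* §3 **`isLocallyConstant_of_forall_mul_mem`** — a right-`U₀`-invariant function on a topological group with `U₀` open is locally constant (for the `Φf_j` when `W` consists of
  right-`U₀`-invariant functions).
HONEST LABEL: pays no socket and no printed citation; the finiteness datum FIN_f («slices of a pair section at level `tauLevel U₀` span a finite-dimensional space») is carried by
the consumer (`[FiniteDimensional ℂ W]`, `hslice`); HC_CM is proved only modulo the 7 printed citations (2 remaining named inputs: hLiu418 = `stmt-HodgeConjecture-24832`, h413 =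
`stmt-HodgeConjecture-24833`) until rung 0 closes; REL ≠ ★ ≠ BUILT; count-neutral.

## References
* [BorelJacquet1979] A. Borel, H. Jacquet, *Automorphic forms and automorphic representations*, PSPM 33.1 (1979), §4.1 (`G(𝔸) = G_∞ × G(𝔸_f)`; finite-dimensionality at a level), 4.3 (i).
* [Flath1979] D. Flath, *Decomposition of representations into tensor products*, PSPM 33.1 (1979), §2 (pure tensors, restricted tensor products).
* N. Bourbaki, *Algèbre* II, ch. II §7 no. 7 (functions of two variables with slices in finite-dimensional spaces are finite sums of products).
-/

set_option autoImplicit false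
set_option linter.dupNamespace false  -- the mandated namespace `…HodgeConjecture.HodgeConjecture.R90.S8` (LEAD #1 L1) repeats the summit's segment

noncomputable section

open NumberField Topology Filter
open Literature.NumberTheory.Automorphic Literature.NumberTheory.Automorphic.UnitaryGroup AdelicGroupData
open Literature.LinearAlgebra.Subspace (exists_points_eval_injective)

namespace Summit.HodgeConjecture.HodgeConjecture.R90.S8

/-! ## §1 Generic: slices in a finite-dimensional space of functions ⇒ a finite sum of products, the first factors being slices -/

section Generic

variable {K : Type*} [Field K] {X Y : Type*}

/-- **SLICES IN A FINITE-DIMENSIONAL SPACE ⇒ FINITE SUM OF PRODUCTS WITH SLICE COEFFICIENTS.**  If `W ≤ (Y → K)` is finite-dimensional and every slice `f x` of `f : X → Y → K`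
lies in `W`, then for `d = dim W` suitable points `y_j : Y` and functions `b_j ∈ W`: `f x y′ = ∑ j, f x (y j) * b j y′` for all `x, y′`.  (Points detecting `W` ★
`exists_points_eval_injective`; a left inverse of the injective restriction map, Mathlib `LinearMap.exists_leftInverse_of_injective`.) [cite: BorelJacquet1979, 4.3 (i)] [cite: Flath1979, §2] -/
theorem exists_sum_slice_mul_of_mem_finiteDimensional (W : Submodule K (Y → K)) [FiniteDimensional K W] (f : X → Y → K) (hf : ∀ x, f x ∈ W) :
    ∃ (d : ℕ) (y : Fin d → Y) (b : Fin d → Y → K), (∀ j, b j ∈ W) ∧ ∀ x y', f x y' = ∑ j, f x (y j) * b j y' := by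
  classical
  obtain ⟨d, y, -, hdet⟩ := exists_points_eval_injective W
  -- the restriction map to the detecting points and a left inverse
  let R : W →ₗ[K] (Fin d → K) := LinearMap.pi fun j => (LinearMap.proj (y j)).comp W.subtype
  have hRapply : ∀ (w : W) (j : Fin d), R w j = (w : Y → K) (y j) := fun w j => rfl
  have hR : LinearMap.ker R = ⊥ := by
    refine LinearMap.ker_eq_bot'.2 fun w hw => ?_
    apply Subtype.ext
    exact hdet w w.2 fun i => by rw [← hRapply w i, hw]; rfl
  obtain ⟨S, hS⟩ := R.exists_leftInverse_of_injective hR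
  refine ⟨d, y, fun j => ((S (fun j' => if j = j' then (1 : K) else 0) : W) : Y → K), fun j => (S _).2, fun x y' => ?_⟩
  have h1 : (⟨f x, hf x⟩ : W) = S (R ⟨f x, hf x⟩) := by
    rw [← LinearMap.comp_apply, hS, LinearMap.id_apply]
  have h2 : R ⟨f x, hf x⟩ = ∑ j, (f x (y j)) • fun j' => if j = j' then (1 : K) else 0 :=
    calc R ⟨f x, hf x⟩ = ∑ j, (R ⟨f x, hf x⟩ j) • fun j' => if j = j' then (1 : K) else 0 := pi_eq_sum_univ _
      _ = ∑ j, (f x (y j)) • fun j' => if j = j' then (1 : K) else 0 :=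
          Finset.sum_congr rfl fun j _ => by rw [hRapply]
  calc f x y' = ((⟨f x, hf x⟩ : W) : Y → K) y' := rfl
    _ = ((S (R ⟨f x, hf x⟩) : W) : Y → K) y' := by rw [← h1]
    _ = ∑ j, f x (y j) * ((S (fun j' => if j = j' then (1 : K) else 0) : W) : Y → K) y' := by
        rw [h2, map_sum]
        simp only [map_smul, Submodule.coe_sum, Submodule.coe_smul, Finset.sum_apply, Pi.smul_apply, smul_eq_mul]

end Generic

/-! ## §2 The adelic reading: `φ(g) = Σ_j φ(ι_∞(g_∞)·ι_f(y_j)) · Φf_j(g_f)` -/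

section Adelic

variable {F E : Type} [Field F] [NumberField F] [Field E] [NumberField E] [Algebra F E] (c : E ≃ₐ[F] E) (N : ℕ) (J : Matrix (Fin N) (Fin N) E)

/-- **«PT-DECOMP» — A FUNCTION ON `U(J)(𝔸_F)` WITH FINITE SLICES IN A FINITE-DIMENSIONAL SPACE IS A FINITE SUM OF PURE TENSORS WITH SLICE ARCHIMEDEAN FACTORS**: if every slice
`y ↦ φ(ι_∞ x · ι_f y)` (`x ∈ U(J)(F_∞)`) lies in a finite-dimensional `W ≤ (U(J)(𝔸_{F,f}) → ℂ)`, then there are `y₁, …, y_d ∈ U(J)(𝔸_{F,f})` and `Φf_j ∈ W` with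
`φ(g) = ∑ j, φ(ι_∞(g_∞)·ι_f(y_j)) · Φf_j(g_f)` for every `g` (`g = ι_∞(g_∞)·ι_f(g_f)`, ★ `archToAdelic_mul_finAdelicToAdelic`).  For a `(χ₁,χ₂)`-pair section right-invariant under
`ι_f(U₀)` (`U₀` open) take `W` = the `B(𝔸_f)`-equivariant right-`U₀`-invariant functions (finite-dimensional by the finite-adelic Iwasawa decomposition — the consumer's FIN_f).
[cite: BorelJacquet1979, §4.1, 4.3 (i)] [cite: Flath1979, §2] -/
theorem exists_finset_sum_pureTensor_of_slices (φ : (adelicGroupData F E c N J).Adelic → ℂ)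
    (W : Submodule ℂ (↥(finAdelic F E c N J) → ℂ)) [FiniteDimensional ℂ W]
    (hslice : ∀ x : ↥(arch F E c N J), (fun y : ↥(finAdelic F E c N J) => φ (archToAdelic F E c N J x * finAdelicToAdelic F E c N J y)) ∈ W) :
    ∃ (d : ℕ) (y : Fin d → ↥(finAdelic F E c N J)) (Φf : Fin d → ↥(finAdelic F E c N J) → ℂ), (∀ j, Φf j ∈ W) ∧
      ∀ g : (adelicGroupData F E c N J).Adelic,
        φ g = ∑ j, φ (archToAdelic F E c N J (archPart F E c N J g) * finAdelicToAdelic F E c N J (y j)) * Φf j (finPart F E c N J g) := by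
  obtain ⟨d, y, b, hb, hsum⟩ := exists_sum_slice_mul_of_mem_finiteDimensional W
    (fun (x : ↥(arch F E c N J)) (y' : ↥(finAdelic F E c N J)) => φ (archToAdelic F E c N J x * finAdelicToAdelic F E c N J y')) hslice
  refine ⟨d, y, b, hb, fun g => ?_⟩
  have hg := hsum (archPart F E c N J g) (finPart F E c N J g)
  rw [archToAdelic_mul_finAdelicToAdelic] at hg
  exact hg

/-- **«PT-DECOMP» IN THE CONSUMER'S SHAPE** (★ `hunfK_at_of_pureTensorSum`: `∑ i ∈ s, fun g => Φinf i (archPart … g) * Φf i (finPart … g)` with `Φinf i` continuous and bounded):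
for `φ` CONTINUOUS with `‖φ‖ ≤ M` and finite slices in a finite-dimensional `W`, `φ = ∑ j ∈ univ, fun g => Φinf j (archPart g) * Φf j (finPart g)` with `Φinf j := fun x => φ(ι_∞ x · ι_f y_j)`
CONTINUOUS, `‖Φinf j x‖ ≤ M`, and `Φf j ∈ W`. [cite: BorelJacquet1979, §4.1, 4.3 (i)] [cite: Flath1979, §2] -/
theorem exists_finset_sum_pureTensor_of_slices' (φ : (adelicGroupData F E c N J).Adelic → ℂ) (hφc : Continuous φ) {M : ℝ} (hφM : ∀ g, ‖φ g‖ ≤ M)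
    (W : Submodule ℂ (↥(finAdelic F E c N J) → ℂ)) [FiniteDimensional ℂ W]
    (hslice : ∀ x : ↥(arch F E c N J), (fun y : ↥(finAdelic F E c N J) => φ (archToAdelic F E c N J x * finAdelicToAdelic F E c N J y)) ∈ W) :
    ∃ (d : ℕ) (Φinf : Fin d → ↥(arch F E c N J) → ℂ) (Φf : Fin d → ↥(finAdelic F E c N J) → ℂ),
      (∀ j, Continuous (Φinf j)) ∧ (∀ j x, ‖Φinf j x‖ ≤ M) ∧ (∀ j, Φf j ∈ W) ∧
      φ = ∑ j ∈ Finset.univ, fun g => Φinf j (archPart F E c N J g) * Φf j (finPart F E c N J g) := by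
  obtain ⟨d, y, Φf, hΦf, hsum⟩ := exists_finset_sum_pureTensor_of_slices c N J φ W hslice
  refine ⟨d, fun j x => φ (archToAdelic F E c N J x * finAdelicToAdelic F E c N J (y j)), Φf, fun j => ?_, fun j x => hφM _, hΦf, ?_⟩
  · exact hφc.comp ((continuous_archToAdelic F E c N J).mul continuous_const)
  · funext g
    rw [hsum g, Finset.sum_apply]

end Adelic

/-! ## §3 Right-invariance under an open subgroup ⇒ local constancy (for the finite factors `Φf_j`) -/

section LocallyConstant

variable {G : Type*} [Group G] [TopologicalSpace G] [ContinuousMul G] {β : Type*}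

/-- **A right-`U₀`-invariant function is locally constant when `U₀` is open**: `f (y u) = f y` for `u ∈ U₀` ⟹ `IsLocallyConstant f` (on the open coset `{y ∣ y₀⁻¹ y ∈ U₀}` of `y₀` the
function is constant).  The `Φf_j` of §2 are locally constant as soon as `W` consists of right-`U₀`-invariant functions. [cite: BorelJacquet1979, §4.1] -/
theorem isLocallyConstant_of_forall_mul_mem (U₀ : Subgroup G) (hU₀ : IsOpen (U₀ : Set G)) (f : G → β) (hf : ∀ (y : G), ∀ u ∈ U₀, f (y * u) = f y) :
    IsLocallyConstant f := by
  refine (IsLocallyConstant.iff_eventually_eq f).2 fun y₀ => ?_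
  have hUo : IsOpen ((fun y : G => y₀⁻¹ * y) ⁻¹' (U₀ : Set G)) := hU₀.preimage (continuous_const.mul continuous_id)
  have h0 : y₀ ∈ (fun y : G => y₀⁻¹ * y) ⁻¹' (U₀ : Set G) := by
    show y₀⁻¹ * y₀ ∈ (U₀ : Set G)
    rw [inv_mul_cancel]; exact U₀.one_mem
  refine eventually_of_mem (hUo.mem_nhds h0) fun y hy => ?_
  have hu : y₀⁻¹ * y ∈ U₀ := hy
  rw [← hf y₀ (y₀⁻¹ * y) hu, mul_inv_cancel_left]

end LocallyConstant

end Summit.HodgeConjecture.HodgeConjecture.R90.S8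

end
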